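import Literature.AlgebraicGeometry.Motives.HypersurfaceLinearSections
import Literature.AlgebraicGeometry.Motives.HyperplaneSectionPushforward
import HarnessLib

/-!
# Degrees of linear sections of a hypersurface: `i_*(c₁(𝒪_X(1))ᶜ ∩ [X]) = e • [Lᵐ]`, `deg = e`

A sequel to `Motives/HypersurfaceLinearSections` (`[X ∩ M] = c₁(𝒪_X(1))ᶜ ∩ [X]` for a hypersurface
`X = V₊(F) ⊆ ℙ^{d+1}` of degree `e` and a linear subspace `M` of codimension `c`): by the projection
formula (Fulton, *Intersection Theory*, Prop. 2.5 (c); `Motives/HyperplaneSectionPushforward`) and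
`i_*[X] = e • [H]` (`Motives/HypersurfaceFundamentalClass`), the class `c₁(𝒪_X(1))ᶜ ∩ [X]` pushes
forward to `e • [Lᵐ]` in `CH_m(ℙ^{m+c+1})` and has degree `e` — e.g. the cubic surface
`S = P₀ ∩ X` in Mboro's proof of Prop. 1.4 (arXiv:1701.04488, p. 8) has degree `3`.

* `ProjSpace.hyperplaneSectionIter` — `c₁(𝒪(1))ᶜ ∩ - : CH_{n+c}(ℙᴺ) → CH_n(ℙᴺ)`;
  `ProjSpace.hyperplaneSectionToZero_add`; `ProjSpace.exists_hyperplaneSectionIter_ofPoint_eq` —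
  `c₁(𝒪(1))ᶜ ∩ [Lⁿ⁺ᶜ] = [Lⁿ]`;
* `ProjSpace.pushforward_hyperplaneSectionOnIter` — **`j_*(c₁(𝒪_X(1))ᶜ ∩ x) = c₁(𝒪(1))ᶜ ∩ j_*x`**;
* `Hypersurface.pushforward_hyperplaneSectionOnIter_fundamentalClass` —
  **`i_*(c₁(𝒪_X(1))ᶜ ∩ [X]) = e • [Lᵐ]`**;
  `Hypersurface.degreeEquiv_pushforward_hyperplaneSectionOnIter_fundamentalClass` — **`deg = e`**.

Everything is proved; the only definition is the iterate `ProjSpace.hyperplaneSectionIter`.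

## References

* W. Fulton, *Intersection Theory*, 2nd ed., Springer (1998): Prop. 2.5 (c), §2.5 and
  Examples 2.5.1–2.5.2 (p. 41), Example 1.9.3 (p. 23). [Fulton1998]
* R. Mboro, *Remarks on the CH₂ of cubic hypersurfaces*, arXiv:1701.04488, proof of Prop. 1.4
  (p. 8). [Mboro2018]
-/

noncomputable section

universe u

open CategoryTheory AlgebraicGeometry Order Topology IsLocalRing
open Literature.AlgebraicGeometry.Motives.RatFn
open Literature.AlgebraicGeometry.Motives.Segre

attribute [local instance] MvPolynomial.gradedAlgebra

namespace Literature.AlgebraicGeometry.Motives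

namespace ProjSpace


/-! ### `c₁(𝒪(1))ᶜ ∩ -` on `ℙᴺ` and the projection formula for iterated sections -/

section Iter

variable (N : ℕ) (K : Type u) [Field K] [Infinite K]

/-- **The iterated hyperplane section `c₁(𝒪(1))ᶜ ∩ - : CH_{n+c}(ℙᴺ_K) → CH_n(ℙᴺ_K)`** (Fulton, §2.5),
the `c`-fold composite of `hyperplaneSection`; `hyperplaneSectionToZero N n` is the case `(0, n)`.
[cite: Fulton1998, §2.5 (p. 41)] -/
def hyperplaneSectionIter (n : ℕ) :
    (c : ℕ) → (ChowGroup (projectiveSpace N K).left (n + c) →+ ChowGroup (projectiveSpace N K).left n)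
  | 0 => AddMonoidHom.id _
  | c + 1 => (hyperplaneSectionIter n c).comp (hyperplaneSection N K (n + c))

/-- `c₁(𝒪(1))⁰ ∩ x = x` (`rfl`). [folklore] -/
@[simp]
theorem hyperplaneSectionIter_zero (n : ℕ) (x : ChowGroup (projectiveSpace N K).left (n + 0)) :
    hyperplaneSectionIter N K n 0 x = x :=
  rfl

/-- `c₁(𝒪(1))ᶜ⁺¹ ∩ x = c₁(𝒪(1))ᶜ ∩ (c₁(𝒪(1)) ∩ x)` (`rfl`). [folklore] -/
theorem hyperplaneSectionIter_succ (n c : ℕ) (x : ChowGroup (projectiveSpace N K).left (n + (c + 1))) :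
    hyperplaneSectionIter N K n (c + 1) x =
      hyperplaneSectionIter N K n c (hyperplaneSection N K (n + c) x) :=
  rfl

/-- `c₁(𝒪(1))ⁿ⁺ᶜ ∩ x = c₁(𝒪(1))ⁿ ∩ (c₁(𝒪(1))ᶜ ∩ x)` down to `CH₀`. [folklore] -/
theorem hyperplaneSectionToZero_add (n : ℕ) :
    ∀ (c : ℕ) (x : ChowGroup (projectiveSpace N K).left (n + c)),
      hyperplaneSectionToZero N (n + c) x = hyperplaneSectionToZero N n (hyperplaneSectionIter N K n c x)
  | 0, _ => rfl
  | c + 1, x => by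
    rw [hyperplaneSectionIter_succ, ← hyperplaneSectionToZero_add n c]
    rfl

variable {N K}

/-- **`c₁(𝒪(1))ᶜ ∩ [Lⁿ⁺ᶜ] = [Lⁿ]`**: the `c`-fold hyperplane section of the class of an `(n + c)`-plane
is the class of an `n`-plane (Fulton, Example 2.5.1, iterated). [cite: Fulton1998, Example 2.5.1 (p. 41)] -/
theorem exists_hyperplaneSectionIter_ofPoint_eq (n : ℕ) :
    ∀ (c : ℕ) {w : ↥(projectiveSpace N K).left}
      (hw : IsLinearSubspacePoint (n + c) N (𝟙 (projectiveSpace N K)) w),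
      ∃ (w' : ↥(projectiveSpace N K).left)
        (hw' : IsLinearSubspacePoint n N (𝟙 (projectiveSpace N K)) w'),
        hyperplaneSectionIter N K n c (ChowGroup.ofPoint w hw.1) = ChowGroup.ofPoint w' hw'.1
  | 0, w, hw => ⟨w, hw, rfl⟩
  | c + 1, w, hw => by
    obtain ⟨w₁, hw₁, h₁⟩ := exists_hyperplaneSection_mk_primeCycle_eq (n := n + c) hw
    obtain ⟨w', hw', h'⟩ := exists_hyperplaneSectionIter_ofPoint_eq n c hw₁
    refine ⟨w', hw', ?_⟩
    rw [hyperplaneSectionIter_succ, ← h']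
    exact congrArg _ h₁

variable {X : SchemeOver K} [IsIntegral X.left] [LocallyOfFiniteType X.hom]

/-- **Projection formula for iterated sections: `j_*(c₁(𝒪_X(1))ᶜ ∩ x) = c₁(𝒪(1))ᶜ ∩ j_*x`** in
`CH_n(ℙᴺ_K)` for the closed immersion `j : X ↪ ℙᴺ` of an integral subvariety
(`pushforward_hyperplaneSectionOn`, iterated; Fulton, Prop. 2.5 (c)). [cite: Fulton1998, Prop. 2.5 (c) (p. 41)] -/
theorem pushforward_hyperplaneSectionOnIter (j : X ⟶ projectiveSpace N K) [IsClosedImmersion j.left]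
    {ℓ₀ : MvPolynomial (Fin (N + 1)) K} (hℓ₀ : ℓ₀ ∈ grading (Fin (N + 1)) K 1) (hℓ₀0 : ℓ₀ ≠ 0)
    (hX : (formDivisor ℓ₀ hℓ₀ hℓ₀0).Avoids (j.left.base (genericPoint ↥X.left))) (n : ℕ) :
    ∀ (c : ℕ) (x : ChowGroup X.left (n + c)),
      ChowGroup.pushforward n (map_mem_ratTrivial_holds n) j (hyperplaneSectionOnIter j hℓ₀ hℓ₀0 hX n c x) =
        hyperplaneSectionIter N K n c
          (ChowGroup.pushforward (n + c) (map_mem_ratTrivial_holds (n + c)) j x)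
  | 0, _ => rfl
  | c + 1, x => by
    rw [hyperplaneSectionOnIter_succ, pushforward_hyperplaneSectionOnIter j hℓ₀ hℓ₀0 hX n c,
      pushforward_hyperplaneSectionOn j hℓ₀ hℓ₀0 hX (n + c) x, hyperplaneSectionIter_succ]
    rfl

end Iter

end ProjSpace

/-! ### Degrees of linear sections of a hypersurface -/

namespace Hypersurface

open ProjSpace

variable {K : Type u} [Field K] [Infinite K] {d e : ℕ} {X : SchemeOver K} [IsIntegral X.left]
  [LocallyOfFiniteType X.hom] (i : X ⟶ projectiveSpace (d + 1) K) [IsClosedImmersion i.left]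
  {F : MvPolynomial (Fin (d + 1 + 1)) K} (hF : F ∈ grading (Fin (d + 1 + 1)) K e) (hprime : Prime F)
  (hrange : Set.range i.left.base =
    ProjectiveSpectrum.zeroLocus (MvPolynomial.homogeneousSubmodule (Fin (d + 1 + 1)) K) {F})
  {ℓ₀ : MvPolynomial (Fin (d + 1 + 1)) K} (hℓ₀ : ℓ₀ ∈ grading (Fin (d + 1 + 1)) K 1) (hℓ₀0 : ℓ₀ ≠ 0)
  (hX₀ : (formDivisor ℓ₀ hℓ₀ hℓ₀0).Avoids (i.left.base (genericPoint ↥X.left)))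

include hF hprime hrange

/-- **`i_*(c₁(𝒪_X(1))ᶜ ∩ [X]) = e • [λ_m]` in `CH_m(ℙ^{m+c+1}_K)`**: the push-forward of the `c`-fold
self-intersection of the hyperplane class of a degree-`e` hypersurface `X ⊆ ℙ^{d+1}`, `d = m + c`,
is `e` times the class of an `m`-plane (projection formula with `i_*[X] = e • [H]`, and
`c₁(𝒪(1))ᶜ ∩ [Lᵐ⁺ᶜ] = [Lᵐ]`; all `m`-planes are rationally equivalent, `K` algebraically closed).
[cite: Fulton1998, Prop. 2.5 (c), Example 2.5.1 and Example 1.9.3 (pp. 23–41)] -/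
theorem pushforward_hyperplaneSectionOnIter_fundamentalClass [IsAlgClosed K] {m c : ℕ} (hdim : m + c = d) :
    ChowGroup.pushforward m (map_mem_ratTrivial_holds m) i
        (hyperplaneSectionOnIter i hℓ₀ hℓ₀0 hX₀ m c
          (ChowGroup.ofPoint (genericPoint ↥X.left)
            (by rw [height_genericPoint i hF hprime hrange]; exact_mod_cast hdim.symm))) =
      e • ChowGroup.ofPoint (X := (projectiveSpace (d + 1) K).left)
        (ProjectiveSpaceCells.coordGenericPoint K (n := d + 1) m)
        (ProjectiveSpaceCells.height_coordGenericPoint K (by omega)) := by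
  subst hdim
  rw [pushforward_hyperplaneSectionOnIter i hℓ₀ hℓ₀0 hX₀ m c,
    pushforward_fundamentalClass i hF hprime hrange, map_nsmul]
  obtain ⟨w', hw', h'⟩ := exists_hyperplaneSectionIter_ofPoint_eq (N := m + c + 1) (K := K) m c
    (ProjectiveSpaceCells.isLinearSubspacePoint_coordGenericPoint K (Nat.le_succ (m + c)))
  rw [h', hw'.ofPoint_eq_ofPoint_of_id
    (ProjectiveSpaceCells.isLinearSubspacePoint_coordGenericPoint K (by omega))]

/-- **The degree of a linear section class: `deg (c₁(𝒪_X(1))ᶜ ∩ [X]) = e`** for a hypersurface of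
degree `e` (`K` algebraically closed; `deg` = `ProjSpace.degreeEquiv` of the push-forward to
`ℙ^{d+1}`), e.g. the cubic surface `S = P₀ ∩ X` of Mboro's Prop. 1.4 has degree `3`.
[cite: Fulton1998, §2.5 and Example 2.5.2 (p. 41)] -/
theorem degreeEquiv_pushforward_hyperplaneSectionOnIter_fundamentalClass [IsAlgClosed K] {m c : ℕ}
    (hdim : m + c = d) :
    degreeEquiv (d + 1) (show m ≤ d + 1 by omega)
      (ChowGroup.pushforward m (map_mem_ratTrivial_holds m) i
        (hyperplaneSectionOnIter i hℓ₀ hℓ₀0 hX₀ m c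
          (ChowGroup.ofPoint (genericPoint ↥X.left)
            (by rw [height_genericPoint i hF hprime hrange]; exact_mod_cast hdim.symm)))) = e := by
  rw [pushforward_hyperplaneSectionOnIter_fundamentalClass i hF hprime hrange hℓ₀ hℓ₀0 hX₀ hdim, map_nsmul,
    degreeEquiv_ofPoint (ProjectiveSpaceCells.isLinearSubspacePoint_coordGenericPoint K (by omega)),
    nsmul_eq_mul, mul_one]

end Hypersurface

end Literature.AlgebraicGeometry.Motives

end
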